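import Literature.Probability.Percolation.DecisionTreeWeighted
import Mathlib.Algebra.BigOperators.Group.Finset.Powerset
import Mathlib.Tactic.Linarith
import Mathlib.Tactic.Ring
import HarnessLib

/-!
# The Gladkov–Zimin complete-positivity realizability test (Theorem 4.3), in dual (kernel) form

Topic `Literature/Probability/Percolation`, in the finitary weighted-cube language of
`DecisionTreeWeighted.lean` (`wtW D p S = ∏_{i ∈ D} (p_i if i ∈ S else 1 - p_i)`, configurations `S ⊆ D`,
fibre masses `PrW D p {S | π S = a}` of a labelling `π` of configurations by a preorder — the `classMass`
of `GladkovZiminKernel.lean`; no measure theory).  Self-contained over `DecisionTreeWeighted.lean` (the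
one-coordinate decomposition is re-derived inline), so that it does not depend on the build state of
`GladkovZiminKernel.lean`.

## Source, as printed

N. Gladkov, A. Zimin, *On Harris–Kleitman type inequalities*, unpublished draft (September 2024)
[GladkovZimin2024HK], §4 "Testing measure realizability on a poset":

"**Theorem 4.3.** If vector `x = {m_p}_{p ∈ P}` is realizable, then there exists a completely positive
`p × p` matrix `M` such that `F M Fᵀ = diag(x) − x xᵀ` (9)."  Here `F` is the `m × p` cover matrix of the
poset (`F_{e,ab} = −1` if `e = a`, `1` if `e = b`, for a cover `a ⋖ b`), "completely positive" means
`M = B Bᵀ` with `B` entrywise nonnegative, and the proof is the one-coordinate induction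
"`diag(x) − xxᵀ = p(F M⁺ Fᵀ) + (1 − p)(F M⁻ Fᵀ) + p(1 − p)(x⁺ − x⁻)(x⁺ − x⁻)ᵀ`" with `x⁺ − x⁻ = F y`,
"all entries of `y` are nonnegative".  The draft continues: "Testing if a particular vector `x` … satisfies
condition (9) for some positive semidefinite matrix `M` with nonnegative entries is a convex optimization
problem", and (Proposition 4.4) "the realizability test of Theorem 4.3 is stronger than this of Theorem 2.3
since it also adds the restriction that `M` is nonnegative definite."

## What is proved here (the DUAL = usable-row form of Theorem 4.3)

By conic duality, Theorem 4.3 says: every kernel `A` whose PAIR KERNEL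
`K_A((a,b),(a',b')) := A a a' + A b b' − A a b' − A b a'` (`a ≤ b`, `a' ≤ b'`) is COPOSITIVE — nonnegative as a
quadratic form on nonnegative vectors indexed by comparable pairs — gives the valid quadratic inequality
`Σ_{a,b} A a b · m_a m_b ≤ Σ_a A a a · m_a` on realizable class-mass vectors.  Theorem 2.3's kernels
(`A a d + A b c ≤ A a c + A b d`, tree: `kernel_classMass_le`) are exactly those with `K_A ≥ 0` ENTRYWISE;
the new content of Theorem 4.3 is the positive-semidefinite part.  We prove:

* **`sum_sum_wtW_le_sum_wtW_diag_of_pairDominance`** — the configuration form: if for every finite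
  coordinate set `D'` and every pair of labellings `σ ≤ τ` (pointwise) the MIXED two-copy average of `A` is
  dominated by the PURE one,
  `Σ_{S,T ⊆ D'} w_S w_T (A(σS, τT) + A(τS, σT)) ≤ Σ_{S,T ⊆ D'} w_S w_T (A(σS, σT) + A(τS, τT))`   (PD)
  (this is `yᵀ A y ≥ 0` for the coupled difference `y = x⁺ − x⁻` of the printed proof, written without `F`),
  then for every monotone labelling `π`,
  `Σ_{S,T ⊆ D} w_S w_T A(πS, πT) ≤ Σ_{S ⊆ D} w_S A(πS, πS)`.
  Proof = the printed induction on the coordinates: the one-coordinate decomposition splits the two-copy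
  side into `(1−q)² X₀₀ + q(1−q)(X₀₁ + X₁₀) + q² X₁₁` and the diagonal side into `(1−q) Y₀ + q Y₁`; (PD) with
  `σ = π`, `τ = π ∘ insert e` gives `X₀₁ + X₁₀ ≤ X₀₀ + X₁₁`, and the induction hypotheses `X₀₀ ≤ Y₀`,
  `X₁₁ ≤ Y₁` finish — verbatim the shape of `ED_ED_le_ED_diag` (Thm 2.1) with the pointwise kernel
  condition replaced by the global one.
* **`pairDominance_of_gram`** — the CHECKABLE sufficient condition for (PD) (= the semidefinite relaxation
  "M nonnegative AND positive semidefinite" of the draft's §4 remark, dualised): if on comparable pairs the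
  pair kernel splits as a Gram matrix plus an entrywise nonnegative kernel,
  `A a a' + A b b' − A a b' − A b a' = Σ_{i<r} G i a b · G i a' b' + N a b a' b'`, `N ≥ 0` (`a ≤ b`, `a' ≤ b'`),
  then (PD) holds (sum of squares plus a nonnegative sum).
* **`kernel_PrW_fiber_le_of_gram`** — Theorem 4.3 (dual, relaxed to PSD + nonnegative) on the label law:
  under the Gram+nonnegative hypothesis, `Σ_{a,b ∈ t} A a b · x_a x_b ≤ Σ_{a ∈ t} A a a · x_a`,
  `x_a = PrW D p {S | π S = a}`, for any finite `t` containing all labels.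
* `pairDominance_of_crossSupermodular` — Theorem 2.3's kernels satisfy (PD) (so this file's theorem contains
  `kernel_classMass_le`; Prop. 4.4 of the draft).

Why this file exists (project use): the percolation certificate searches of
`Summits/CriticalPhenomena/PercolationContinuityZ3` (crux `NoHeavyLowerTail`, KN Question 7 at `|A| = 3`) found
exact pseudo-laws inside the cone of ALL Theorem-2.3 rows on the partition lattice of five terminals
("GZ cone", ttrl `gz/README.md` RESULT 1b); Theorem 4.3's semidefinite part is the printed family of valid
quadratic rows not yet used there, and this file makes those rows kernel-checkable (a rational Gram factor `G`
and a nonnegative remainder `N` are the certificate).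

## References

* N. Gladkov, A. Zimin, *On Harris–Kleitman type inequalities*, unpublished draft, September 2024, §4,
  Def. 4.1–4.2, Thm. 4.3, Prop. 4.4. [GladkovZimin2024HK]
* A. Berman, N. Shaked-Monderer, *Completely positive matrices*, World Scientific 2003 (duality of the
  completely positive and copositive cones; the doubly-nonnegative relaxation). [BermanShakedMonderer2003]
-/

noncomputable section

namespace Literature.Probability.Percolation

namespace DecisionTree

open Finset

variable {ι : Type*} [DecidableEq ι]

/-! ### One-coordinate decomposition -/

/-- **One-coordinate decomposition of a weighted sum** ("split the cube into the upper and lower halves"):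
`Σ_{S ⊆ insert e D} w S · φ S = (1 - p_e) Σ_{S ⊆ D} w S · φ S + p_e Σ_{S ⊆ D} w S · φ (insert e S)` for `e ∉ D`.
[cite: GladkovZimin2024HK, proof of Thm. 4.3 (§4)] -/
theorem sum_wtW_mul_insert_decomp {D : Finset ι} {e : ι} (p : ι → ℝ) (he : e ∉ D)
    (φ : Finset ι → ℝ) :
    ∑ S ∈ (insert e D).powerset, wtW (insert e D) p S * φ S =
      (1 - p e) * ∑ S ∈ D.powerset, wtW D p S * φ S +
        p e * ∑ S ∈ D.powerset, wtW D p S * φ (insert e S) := by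
  rw [Finset.sum_powerset_insert he, Finset.mul_sum, Finset.mul_sum]
  congr 1
  · refine Finset.sum_congr rfl fun S hS => ?_
    have heS : e ∉ S := fun h => he (Finset.mem_powerset.1 hS h)
    have hw : wtW (insert e D) p S = (1 - p e) * wtW D p S := by
      unfold wtW
      rw [Finset.prod_insert he, if_neg heS]
    rw [hw, mul_assoc]
  · refine Finset.sum_congr rfl fun S _ => ?_
    have hw : wtW (insert e D) p (insert e S) = p e * wtW D p S := by
      unfold wtW
      rw [Finset.prod_insert he, if_pos (Finset.mem_insert_self e S)]
      congr 1
      refine Finset.prod_congr rfl fun i hi => ?_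
      have hie : i ≠ e := fun h => he (h ▸ hi)
      simp only [Finset.mem_insert, hie, false_or]
    rw [hw, mul_assoc]

/-- A weighted sum of a function of the label is the sum over labels against the fibre masses
`PrW D p {S | π S = a}`. [folklore] -/
theorem sum_wtW_mul_comp_eq_sum_PrW_fiber (D : Finset ι) (p : ι → ℝ) {κ : Type*} [DecidableEq κ]
    (π : Finset ι → κ) (t : Finset κ) (ht : ∀ S ∈ D.powerset, π S ∈ t) (φ : κ → ℝ) :
    ∑ S ∈ D.powerset, wtW D p S * φ (π S) = ∑ a ∈ t, φ a * PrW D p {S | π S = a} := by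
  have hfib : ∀ a : κ, PrW D p {S | π S = a} = ∑ S ∈ D.powerset with π S = a, wtW D p S := by
    intro a
    unfold PrW
    rw [Finset.sum_filter]
    refine Finset.sum_congr rfl fun S _ => ?_
    by_cases h : π S = a
    · rw [if_pos h, Set.indicator_of_mem (by exact h)]
    · rw [if_neg h, Set.indicator_of_notMem (by exact h)]
  simp only [hfib]
  rw [← Finset.sum_fiberwise_of_maps_to ht]
  refine Finset.sum_congr rfl fun a _ => ?_
  rw [Finset.mul_sum]
  refine Finset.sum_congr rfl fun S hS => ?_
  rw [(Finset.mem_filter.1 hS).2, mul_comm]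

/-! ### Theorem 4.3, dual form, on configurations -/

/-- **Gladkov–Zimin, Theorem 4.3 (complete-positivity test), dual form on configurations.**  Let
`p ∈ [0,1]^ι` and let the kernel `A` on a preorder satisfy PAIR DOMINANCE: for every finite coordinate set
`D'` and all labellings `σ ≤ τ` (pointwise), the mixed two-copy average of `A` is at most the pure one,
`Σ_{S,T} w_S w_T (A(σS,τT) + A(τS,σT)) ≤ Σ_{S,T} w_S w_T (A(σS,σT) + A(τS,τT))` (this is `yᵀAy ≥ 0` for the
coupled difference vector `y = x⁺ − x⁻ = F·(nonnegative)` of the printed proof), for labellings with values in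
a fixed label set `t`.  Then for every labelling `π` with values in `t`, monotone along `⊆`:  `Σ_{S,T ⊆ D} w_S w_T · A(πS, πT) ≤ Σ_{S ⊆ D} w_S · A(πS, πS)`.
Proof: the printed one-coordinate induction ("split the cube into the upper and lower halves").
[cite: GladkovZimin2024HK, Thm. 4.3 (§4, proof)] -/
theorem sum_sum_wtW_le_sum_wtW_diag_of_pairDominance (D : Finset ι) {p : ι → ℝ}
    (hp0 : ∀ i, 0 ≤ p i) (hp1 : ∀ i, p i ≤ 1) {κ : Type*} [Preorder κ] (t : Finset κ)
    (A : κ → κ → ℝ)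
    (hA : ∀ (D' : Finset ι) (σ τ : Finset ι → κ), (∀ S, σ S ∈ t) → (∀ S, τ S ∈ t) →
      (∀ S, σ S ≤ τ S) →
      ∑ S ∈ D'.powerset, ∑ T ∈ D'.powerset,
          wtW D' p S * wtW D' p T * (A (σ S) (τ T) + A (τ S) (σ T)) ≤
        ∑ S ∈ D'.powerset, ∑ T ∈ D'.powerset,
          wtW D' p S * wtW D' p T * (A (σ S) (σ T) + A (τ S) (τ T))) :
    ∀ π : Finset ι → κ, (∀ S, π S ∈ t) → (∀ ⦃x y : Finset ι⦄, x ⊆ y → π x ≤ π y) →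
      ∑ S ∈ D.powerset, ∑ T ∈ D.powerset, wtW D p S * wtW D p T * A (π S) (π T) ≤
        ∑ S ∈ D.powerset, wtW D p S * A (π S) (π S) := by
  induction D using Finset.induction_on with
  | empty =>
    intro π _ _
    simp [wtW]
  | @insert e D' he ih =>
    intro π hπt hπ
    have hq0 : 0 ≤ p e := hp0 e
    have hq1 : 0 ≤ 1 - p e := sub_nonneg.2 (hp1 e)
    -- the upper section of the labelling
    have hπ₁mono : ∀ ⦃x y : Finset ι⦄, x ⊆ y → π (insert e x) ≤ π (insert e y) :=
      fun x y hxy => hπ (Finset.insert_subset_insert e hxy)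
    have hle : ∀ S, π S ≤ π (insert e S) := fun S => hπ (Finset.subset_insert e S)
    have hπ₁t : ∀ S, π (insert e S) ∈ t := fun S => hπt (insert e S)
    -- abbreviations for the sections
    have hsplit1 : ∀ φ : Finset ι → ℝ,
        ∑ S ∈ (insert e D').powerset, wtW (insert e D') p S * φ S =
          (1 - p e) * ∑ S ∈ D'.powerset, wtW D' p S * φ S +
            p e * ∑ S ∈ D'.powerset, wtW D' p S * φ (insert e S) :=
      fun φ => sum_wtW_mul_insert_decomp p he φ
    -- generic double-sum bookkeeping on `D'`
    have hdouble : ∀ g : Finset ι → Finset ι → ℝ,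
        ∑ S ∈ D'.powerset, wtW D' p S * ∑ T ∈ D'.powerset, wtW D' p T * g S T =
          ∑ S ∈ D'.powerset, ∑ T ∈ D'.powerset, wtW D' p S * wtW D' p T * g S T := by
      intro g
      refine Finset.sum_congr rfl fun S _ => ?_
      rw [Finset.mul_sum]
      exact Finset.sum_congr rfl fun T _ => by ring
    -- decomposition of the two-copy side
    have hL : ∑ S ∈ (insert e D').powerset, ∑ T ∈ (insert e D').powerset,
          wtW (insert e D') p S * wtW (insert e D') p T * A (π S) (π T) =
        (1 - p e) * ((1 - p e) * ∑ S ∈ D'.powerset, ∑ T ∈ D'.powerset,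
              wtW D' p S * wtW D' p T * A (π S) (π T) +
            p e * ∑ S ∈ D'.powerset, ∑ T ∈ D'.powerset,
              wtW D' p S * wtW D' p T * A (π S) (π (insert e T))) +
          p e * ((1 - p e) * ∑ S ∈ D'.powerset, ∑ T ∈ D'.powerset,
              wtW D' p S * wtW D' p T * A (π (insert e S)) (π T) +
            p e * ∑ S ∈ D'.powerset, ∑ T ∈ D'.powerset,
              wtW D' p S * wtW D' p T * A (π (insert e S)) (π (insert e T))) := by
      -- factor the outer weight out of the inner sums
      have h1 : ∀ S ∈ (insert e D').powerset,
          ∑ T ∈ (insert e D').powerset, wtW (insert e D') p S * wtW (insert e D') p T * A (π S) (π T) =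
            wtW (insert e D') p S *
              ∑ T ∈ (insert e D').powerset, wtW (insert e D') p T * A (π S) (π T) := by
        intro S _
        rw [Finset.mul_sum]
        exact Finset.sum_congr rfl fun T _ => by ring
      rw [Finset.sum_congr rfl h1, hsplit1]
      -- split the inner sums
      have h2 : ∀ S : Finset ι,
          ∑ T ∈ (insert e D').powerset, wtW (insert e D') p T * A (π S) (π T) =
            (1 - p e) * ∑ T ∈ D'.powerset, wtW D' p T * A (π S) (π T) +
              p e * ∑ T ∈ D'.powerset, wtW D' p T * A (π S) (π (insert e T)) :=
        fun S => hsplit1 (fun T => A (π S) (π T))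
      simp only [h2]
      rw [← hdouble (fun S T => A (π S) (π T)), ← hdouble (fun S T => A (π S) (π (insert e T))),
        ← hdouble (fun S T => A (π (insert e S)) (π T)),
        ← hdouble (fun S T => A (π (insert e S)) (π (insert e T)))]
      simp only [mul_add, Finset.mul_sum, Finset.sum_add_distrib]
      ring_nf
    -- decomposition of the diagonal side
    have hR : ∑ S ∈ (insert e D').powerset, wtW (insert e D') p S * A (π S) (π S) =
        (1 - p e) * ∑ S ∈ D'.powerset, wtW D' p S * A (π S) (π S) +
          p e * ∑ S ∈ D'.powerset, wtW D' p S * A (π (insert e S)) (π (insert e S)) :=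
      hsplit1 (fun S => A (π S) (π S))
    -- pair dominance for `σ = π`, `τ = π ∘ insert e` on `D'`: mixed ≤ pure
    have hK : ∑ S ∈ D'.powerset, ∑ T ∈ D'.powerset,
            wtW D' p S * wtW D' p T * A (π S) (π (insert e T)) +
          ∑ S ∈ D'.powerset, ∑ T ∈ D'.powerset,
            wtW D' p S * wtW D' p T * A (π (insert e S)) (π T) ≤
        ∑ S ∈ D'.powerset, ∑ T ∈ D'.powerset,
            wtW D' p S * wtW D' p T * A (π S) (π T) +
          ∑ S ∈ D'.powerset, ∑ T ∈ D'.powerset,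
            wtW D' p S * wtW D' p T * A (π (insert e S)) (π (insert e T)) := by
      have h := hA D' π (fun S => π (insert e S)) hπt hπ₁t hle
      rw [← Finset.sum_add_distrib, ← Finset.sum_add_distrib]
      have hl : ∑ S ∈ D'.powerset, ∑ T ∈ D'.powerset,
            wtW D' p S * wtW D' p T * (A (π S) (π (insert e T)) + A (π (insert e S)) (π T)) =
          ∑ S ∈ D'.powerset, (∑ T ∈ D'.powerset, wtW D' p S * wtW D' p T * A (π S) (π (insert e T)) +
            ∑ T ∈ D'.powerset, wtW D' p S * wtW D' p T * A (π (insert e S)) (π T)) := by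
        refine Finset.sum_congr rfl fun S _ => ?_
        rw [← Finset.sum_add_distrib]
        exact Finset.sum_congr rfl fun T _ => by ring
      have hr : ∑ S ∈ D'.powerset, ∑ T ∈ D'.powerset,
            wtW D' p S * wtW D' p T * (A (π S) (π T) + A (π (insert e S)) (π (insert e T))) =
          ∑ S ∈ D'.powerset, (∑ T ∈ D'.powerset, wtW D' p S * wtW D' p T * A (π S) (π T) +
            ∑ T ∈ D'.powerset, wtW D' p S * wtW D' p T * A (π (insert e S)) (π (insert e T))) := by
        refine Finset.sum_congr rfl fun S _ => ?_
        rw [← Finset.sum_add_distrib]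
        exact Finset.sum_congr rfl fun T _ => by ring
      rw [hl, hr] at h
      exact h
    have hI0 : ∑ S ∈ D'.powerset, ∑ T ∈ D'.powerset, wtW D' p S * wtW D' p T * A (π S) (π T) ≤
        ∑ S ∈ D'.powerset, wtW D' p S * A (π S) (π S) := ih π hπt (fun x y hxy => hπ hxy)
    have hI1 : ∑ S ∈ D'.powerset, ∑ T ∈ D'.powerset,
          wtW D' p S * wtW D' p T * A (π (insert e S)) (π (insert e T)) ≤
        ∑ S ∈ D'.powerset, wtW D' p S * A (π (insert e S)) (π (insert e S)) :=
      ih (fun S => π (insert e S)) hπ₁t hπ₁mono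
    rw [hL, hR]
    -- abbreviate
    set q : ℝ := p e with hq
    set X00 := ∑ S ∈ D'.powerset, ∑ T ∈ D'.powerset, wtW D' p S * wtW D' p T * A (π S) (π T)
    set X01 := ∑ S ∈ D'.powerset, ∑ T ∈ D'.powerset,
      wtW D' p S * wtW D' p T * A (π S) (π (insert e T))
    set X10 := ∑ S ∈ D'.powerset, ∑ T ∈ D'.powerset,
      wtW D' p S * wtW D' p T * A (π (insert e S)) (π T)
    set X11 := ∑ S ∈ D'.powerset, ∑ T ∈ D'.powerset,
      wtW D' p S * wtW D' p T * A (π (insert e S)) (π (insert e T))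
    set Y0 := ∑ S ∈ D'.powerset, wtW D' p S * A (π S) (π S)
    set Y1 := ∑ S ∈ D'.powerset, wtW D' p S * A (π (insert e S)) (π (insert e S))
    have h1 : (1 - q) * q * (X01 + X10) ≤ (1 - q) * q * (X00 + X11) :=
      mul_le_mul_of_nonneg_left hK (mul_nonneg hq1 hq0)
    have h2 : (1 - q) * X00 ≤ (1 - q) * Y0 := mul_le_mul_of_nonneg_left hI0 hq1
    have h3 : q * X11 ≤ q * Y1 := mul_le_mul_of_nonneg_left hI1 hq0
    nlinarith [h1, h2, h3]

/-! ### The checkable sufficient condition: Gram + nonnegative pair kernel -/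

/-- **Pair dominance from a Gram-plus-nonnegative decomposition of the pair kernel** (the semidefinite
relaxation "`M` nonnegative and positive semidefinite" of the draft's §4, dualised).  If on comparable pairs
`a ≤ b`, `a' ≤ b'` the pair kernel splits as
`A a a' + A b b' − A a b' − A b a' = Σ_{i<r} G i a b · G i a' b' + N a b a' b'` with `N ≥ 0` (labels in a
fixed finite set `t`), then for all weights `p ∈ [0,1]^ι`, every `D'` and all `t`-valued labellings `σ ≤ τ`,
`Σ_{S,T} w_S w_T (A(σS,τT) + A(τS,σT)) ≤ Σ_{S,T} w_S w_T (A(σS,σT) + A(τS,τT))`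
(the difference is `Σ_i (Σ_S w_S G i (σS) (τS))² + Σ_{S,T} w_S w_T N ≥ 0`).
[cite: GladkovZimin2024HK, §4 (Thm. 4.3, Def. 4.2, remark after the proof)] -/
theorem pairDominance_of_gram {p : ι → ℝ} (hp0 : ∀ i, 0 ≤ p i) (hp1 : ∀ i, p i ≤ 1)
    {κ : Type*} [Preorder κ] (t : Finset κ) (A : κ → κ → ℝ) (r : ℕ) (G : Fin r → κ → κ → ℝ)
    (N : κ → κ → κ → κ → ℝ)
    (hN : ∀ a b a' b', a ∈ t → b ∈ t → a' ∈ t → b' ∈ t → a ≤ b → a' ≤ b' → 0 ≤ N a b a' b')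
    (hK : ∀ a b a' b', a ∈ t → b ∈ t → a' ∈ t → b' ∈ t → a ≤ b → a' ≤ b' →
      A a a' + A b b' - A a b' - A b a' = ∑ i : Fin r, G i a b * G i a' b' + N a b a' b')
    (D' : Finset ι) (σ τ : Finset ι → κ) (hσ : ∀ S, σ S ∈ t) (hτ : ∀ S, τ S ∈ t)
    (hστ : ∀ S, σ S ≤ τ S) :
    ∑ S ∈ D'.powerset, ∑ T ∈ D'.powerset,
        wtW D' p S * wtW D' p T * (A (σ S) (τ T) + A (τ S) (σ T)) ≤
      ∑ S ∈ D'.powerset, ∑ T ∈ D'.powerset,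
        wtW D' p S * wtW D' p T * (A (σ S) (σ T) + A (τ S) (τ T)) := by
  -- abbreviations
  set P := D'.powerset with hP
  set w : Finset ι → ℝ := fun S => wtW D' p S with hw
  set g : Fin r → Finset ι → ℝ := fun i S => G i (σ S) (τ S) with hg
  set n : Finset ι → Finset ι → ℝ := fun S T => N (σ S) (τ S) (σ T) (τ T) with hn
  have hw0 : ∀ S, 0 ≤ w S := fun S => wtW_nonneg D' hp0 hp1 S
  rw [← sub_nonneg, ← Finset.sum_sub_distrib]
  -- termwise: pure − mixed = Σ_i g_i(S) g_i(T) + n(S,T), weighted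
  have hrw : ∀ S ∈ P,
      (∑ T ∈ P, wtW D' p S * wtW D' p T * (A (σ S) (σ T) + A (τ S) (τ T)) -
        ∑ T ∈ P, wtW D' p S * wtW D' p T * (A (σ S) (τ T) + A (τ S) (σ T))) =
      ∑ T ∈ P, (∑ i : Fin r, (w S * g i S) * (w T * g i T)) + ∑ T ∈ P, w S * w T * n S T := by
    intro S _
    rw [← Finset.sum_sub_distrib, ← Finset.sum_add_distrib]
    refine Finset.sum_congr rfl fun T _ => ?_
    have hk := hK (σ S) (τ S) (σ T) (τ T) (hσ S) (hτ S) (hσ T) (hτ T) (hστ S) (hστ T)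
    have e1 : wtW D' p S * wtW D' p T * (A (σ S) (σ T) + A (τ S) (τ T)) -
        wtW D' p S * wtW D' p T * (A (σ S) (τ T) + A (τ S) (σ T)) =
        w S * w T * (A (σ S) (σ T) + A (τ S) (τ T) - A (σ S) (τ T) - A (τ S) (σ T)) := by
      simp only [hw]; ring
    rw [e1, hk, mul_add, Finset.mul_sum]
    congr 1
    exact Finset.sum_congr rfl fun i _ => by simp only [hg]; ring
  rw [Finset.sum_congr rfl hrw, Finset.sum_add_distrib]
  refine add_nonneg ?_ ?_
  · -- Gram part: Σ_S Σ_T Σ_i (w g_i)(S) (w g_i)(T) = Σ_i (Σ_S w g_i)^2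
    have hcomm : ∑ S ∈ P, ∑ T ∈ P, ∑ i : Fin r, (w S * g i S) * (w T * g i T) =
        ∑ i : Fin r, (∑ S ∈ P, w S * g i S) * (∑ T ∈ P, w T * g i T) := by
      rw [Finset.sum_comm]
      have h2 : ∀ T ∈ P, ∑ S ∈ P, ∑ i : Fin r, (w S * g i S) * (w T * g i T) =
          ∑ i : Fin r, ∑ S ∈ P, (w S * g i S) * (w T * g i T) := fun T _ => Finset.sum_comm
      rw [Finset.sum_congr rfl h2, Finset.sum_comm]
      refine Finset.sum_congr rfl fun i _ => ?_
      rw [Finset.sum_mul_sum, Finset.sum_comm]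
    rw [hcomm]
    exact Finset.sum_nonneg fun i _ => by
      have : (∑ S ∈ P, w S * g i S) * (∑ T ∈ P, w T * g i T) = (∑ S ∈ P, w S * g i S) ^ 2 := by
        rw [sq]
      rw [this]; exact sq_nonneg _
  · exact Finset.sum_nonneg fun S _ => Finset.sum_nonneg fun T _ =>
      mul_nonneg (mul_nonneg (hw0 S) (hw0 T))
        (by simp only [hn]; exact hN _ _ _ _ (hσ S) (hτ S) (hσ T) (hτ T) (hστ S) (hστ T))

/-- **Theorem 2.3's kernels satisfy pair dominance** (the draft's Prop. 4.4: the complete-positivity test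
contains the cross-supermodular one): if `A a d + A b c ≤ A a c + A b d` whenever `a ≤ b`, `c ≤ d`, then
pair dominance holds (pointwise). [cite: GladkovZimin2024HK, Prop. 4.4] -/
theorem pairDominance_of_crossSupermodular {p : ι → ℝ} (hp0 : ∀ i, 0 ≤ p i) (hp1 : ∀ i, p i ≤ 1)
    {κ : Type*} [Preorder κ] (A : κ → κ → ℝ)
    (hA : ∀ ⦃a b c d : κ⦄, a ≤ b → c ≤ d → A a d + A b c ≤ A a c + A b d)
    (D' : Finset ι) (σ τ : Finset ι → κ) (hστ : ∀ S, σ S ≤ τ S) :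
    ∑ S ∈ D'.powerset, ∑ T ∈ D'.powerset,
        wtW D' p S * wtW D' p T * (A (σ S) (τ T) + A (τ S) (σ T)) ≤
      ∑ S ∈ D'.powerset, ∑ T ∈ D'.powerset,
        wtW D' p S * wtW D' p T * (A (σ S) (σ T) + A (τ S) (τ T)) := by
  refine Finset.sum_le_sum fun S _ => Finset.sum_le_sum fun T _ => ?_
  refine mul_le_mul_of_nonneg_left ?_ (mul_nonneg (wtW_nonneg D' hp0 hp1 S) (wtW_nonneg D' hp0 hp1 T))
  have h := hA (hστ S) (hστ T)
  linarith

/-! ### Theorem 4.3 (dual, PSD + nonnegative relaxation) on the label law -/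

/-- **Gladkov–Zimin, Theorem 4.3 in row form on the law of the labels.**  With `x_a = PrW D p {S | π S = a}`
the fibre masses of a labelling `π` that is monotone along `⊆` into a preorder (values in a finite label set
`t`), and a kernel `A` whose pair kernel on comparable pairs of `t` is a Gram matrix plus an entrywise
nonnegative kernel (`hK`, `hN`):  `Σ_{a,b ∈ t} A a b · x_a x_b ≤ Σ_{a ∈ t} A a a · x_a`.  This is the
(doubly-nonnegative relaxation of the) copositive dual of "`F M Fᵀ = diag(x) − xxᵀ` with `M` completely
positive"; it strictly extends the cross-supermodular kernels of Theorem 2.3.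
[cite: GladkovZimin2024HK, Thm. 4.3, Prop. 4.4] -/
theorem kernel_PrW_fiber_le_of_gram (D : Finset ι) {p : ι → ℝ} (hp0 : ∀ i, 0 ≤ p i) (hp1 : ∀ i, p i ≤ 1)
    {κ : Type*} [Preorder κ] [DecidableEq κ] (π : Finset ι → κ)
    (hπ : ∀ ⦃x y : Finset ι⦄, x ⊆ y → π x ≤ π y) (t : Finset κ) (ht : ∀ S, π S ∈ t)
    (A : κ → κ → ℝ) (r : ℕ) (G : Fin r → κ → κ → ℝ) (N : κ → κ → κ → κ → ℝ)
    (hN : ∀ a b a' b', a ∈ t → b ∈ t → a' ∈ t → b' ∈ t → a ≤ b → a' ≤ b' → 0 ≤ N a b a' b')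
    (hK : ∀ a b a' b', a ∈ t → b ∈ t → a' ∈ t → b' ∈ t → a ≤ b → a' ≤ b' →
      A a a' + A b b' - A a b' - A b a' = ∑ i : Fin r, G i a b * G i a' b' + N a b a' b') :
    ∑ a ∈ t, ∑ b ∈ t, A a b * (PrW D p {S | π S = a} * PrW D p {S | π S = b}) ≤
      ∑ a ∈ t, A a a * PrW D p {S | π S = a} := by
  have ht' : ∀ S ∈ D.powerset, π S ∈ t := fun S _ => ht S
  have h := sum_sum_wtW_le_sum_wtW_diag_of_pairDominance D hp0 hp1 t A
    (fun D' σ τ hσ hτ hστ => pairDominance_of_gram hp0 hp1 t A r G N hN hK D' σ τ hσ hτ hστ) π ht hπ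
  -- rewrite the diagonal side
  rw [sum_wtW_mul_comp_eq_sum_PrW_fiber D p π t ht' (fun a => A a a)] at h
  -- rewrite the two-copy side, inner sum first
  have hinner : ∀ S ∈ D.powerset,
      ∑ T ∈ D.powerset, wtW D p S * wtW D p T * A (π S) (π T) =
        wtW D p S * ∑ b ∈ t, A (π S) b * PrW D p {T | π T = b} := by
    intro S _
    rw [← sum_wtW_mul_comp_eq_sum_PrW_fiber D p π t ht' (fun b => A (π S) b), Finset.mul_sum]
    exact Finset.sum_congr rfl fun T _ => by ring
  rw [Finset.sum_congr rfl hinner,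
    sum_wtW_mul_comp_eq_sum_PrW_fiber D p π t ht' (fun a => ∑ b ∈ t, A a b * PrW D p {T | π T = b})]
    at h
  calc ∑ a ∈ t, ∑ b ∈ t, A a b * (PrW D p {S | π S = a} * PrW D p {S | π S = b})
      = ∑ a ∈ t, (∑ b ∈ t, A a b * PrW D p {T | π T = b}) * PrW D p {S | π S = a} := by
        refine Finset.sum_congr rfl fun a _ => ?_
        rw [Finset.sum_mul]
        exact Finset.sum_congr rfl fun b _ => by ring
    _ ≤ ∑ a ∈ t, A a a * PrW D p {S | π S = a} := h

end DecisionTree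

end Literature.Probability.Percolation
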